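import Literature.NumberTheory.Automorphic.UnitaryLatticeTreeTubeCone                  -- ★ p848446 (this seat): (c3-i…v); brings ★ TubeAxisVertex, ★ TubeCoordinate
import Literature.NumberTheory.Automorphic.UnitaryLatticeTreeGluedChildValueRamified  -- ★ p847504: the glued-child value law
import HarnessLib

/-!
# The lattice graph of a hermitian space — COLLAR TOKENS: fixedness, levels and class of a COLLAR lattice (tube coordinate `1`) below an AXIS VERTEX of level `D` of a block
# element are read on ONE residual value — the type-(2) twin of the root-grandchild label law (Kottwitz 1986 §3; Rogawski 1990 §4.9; Bruhat–Tits 1972 §10)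

Topic `NumberTheory/Automorphic`; namespace `Literature.NumberTheory.Automorphic.UnitaryLatticeTree`.  THEOREMS ONLY (no definition, no instance, no notation, no named fact,
no `sorry`); kernel lane `--supports stmt-HodgeConjecture-24833`; datum-free (`K` with `Valued K ℤᵐ⁰`; `[IsPrincipalIdealRing 𝒪[K]]` for the axis-vertex basis, discharged
downstream by ★ `isPrincipalIdealRing_integer_adicCompletion`).  Cell `pub/hodgecm-mathlib`, crux H413; road «S3-ram» (count-neutral), (T2) G-side organ (Cnt2′) of chair
F0P3a-p07 (g14), sub-organ **(z1-c) TUBE LAYERS**, PART II(b = 1) **«COLLAR TOKENS»** (ruling (6) «YES from you … ROW-ROOT-LBL twin shape»).  Over ★ `UnitaryLatticeTreeTubeCone`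
(p848446), ★ `UnitaryLatticeTreeTubeAxisVertex` (p848332), ★ `UnitaryLatticeTreeTubeCoordinate` (p848197) and ★ `UnitaryLatticeTreeGluedChildValueRamified` (p847504).
Seat F0P2-p01 (g16).  HONEST LABEL: HC_CM is proved only modulo the 2 remaining named inputs (hLiu418 24832, h413 24833) until rung 0 closes; elementary lattice algebra,
no books consequence.

THE MATHEMATICS.  Block currency: `H = !![H₂ 0 0, 0, H₂ 0 1; 0, h, 0; H₂ 1 0, 0, H₂ 1 1]` (hermitian, `det H₂ ≠ 0`, `|h| = 1`, `σ h = h`), `Γ = ι(γ₂, u) = endoGL (γ₂, u)`.  A COLLAR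
lattice is a self-dual `M` with tube coordinate `1` (`c·e₁ ∈ M ⟺ |c| ≤ |ϖ|`); `x₀` a generator (`|x₀,₁| = |ϖ|⁻¹`), `A(M) = (M ∩ W) ⊔ ϖ·M ⊔ 𝒪e₁` its axis vertex (★ p848332:
self-dual, `= latt ι(g₂,1)`), `x := ϖ·x₀ ∈ A(M)` the residual line of `A(M)` through which `M` is glued.  HYPOTHESIS: the axis vertex has LEVEL `≥ D ≥ 2`:
`(Γ − 1)·A(M) ⊆ ϖ^D·A(M)` (in the root-region run of the type-(2) count, the region vertices).  VALUE: `val := ϖ^{−D}·⟨x, (Γ − 1)x⟩` (`|val| ≤ 1`; residually the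
★ `…TypeTwoRamifiedCollarCensus` value `Q(v_b) = g(A + hCb²)` of the isotropic line `v_b = x̄`).
* `collar_fixed_and_lev_of_axisLevel`: **`Γ·M ⊆ M`** (the whole collar of a `2`-deep axis vertex is fixed), **`LEV_M(ϖ^{D−2})`**, and **`LEV_M(ϖ^{D−1}) ⟺ |val| < 1`**.
  Proof: the level-`c` tube criterion on the cone (★ p848446 `forall_mulVec_mem_scaleLattice_iff_of_cone`) with `S = Γ − 1`, `c = ϖ^e`: the line clause is `|u − 1| ≤ |ϖ|^D`
  (pair the axis level with `e₁`), the W-clause is `(Γ−1)(M ∩ W) ⊆ ϖ^D A(M) ⊆ ϖ^{D−1}M` (`ϖ·A(M) ≤ M`), the generator clause is `(Γ − u)z ∈ ϖ^D A(M)` (`z = ϖ·pr_W x₀`), and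
  the value clause `|⟨z, (Γ − u)z⟩| ≤ |ϖ|^{e+2}` holds for `e = D − 2` by integrality of `A(M)` and for `e = D − 1` iff `|val| < 1` (★ p848446 `pairing_add_single_endoGL_sub_one`:
  `⟨x, (Γ−1)x⟩ = ⟨z, (Γ−u)z⟩ + (u−1)(⟨z,z⟩ + hN(ϖx₀,₁))`, the correction of size `≤ |ϖ|^{D+2}`).
* `collar_class_iff_of_axisLevel`: if `|val| = 1` then for every unit `c₀`:
  **`(∃ y ∈ M, ∃ a, |a| = 1 ∧ |ϖ^{−(D−2)}⟨y, (Γ−1)y⟩ − c₀a²| < 1) ⟺ ∃ a, |a| = 1 ∧ |val + c₀a²| < 1`** — the depth-`(D−2)` class of the collar lattice is the class of `−val`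
  (★ p847504 `v_pairing_glued_mulVec_add_sq_mul_lt` ∕ `…_sub_mul_sq_lt_of_unit` with parent `A(M)`: every `y = w + t·x₀` has value `≡ −t²·val`).
* `collar_levSq_of_axisLevel`: **`(Γ − 1)²·M ⊆ ϖ^{2D−2}·M`** — the rank token `LEV₂(ϖ^{2(D−2)+1})` of the `1±` labels holds on the whole collar
  (`(Γ−1)² − (u−1)² = (Γ − 1 + (u − 1))(Γ − u)`, `(Γ − u)x₀ ∈ ϖ^{D−1}A(M)`, `(Γ − 1 + (u−1))·ϖ^D A(M) ⊆ ϖ^{2D} A(M) ⊆ ϖ^{2D−1} M`).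
So the labels of the collar below a level-`D` axis vertex are: `val ∈ 𝔪` ⇒ depth `≥ D − 1` («`0`»-type when `D ≥ 3`); `val` a unit ⇒ depth exactly `D − 2` with class `−val`
(«`1±`» at `D = 3`) — the type-(2) twin of ★ `rootGrandchildLabels_equilateral` ∕ ★ `offRegionGrandchildLabels`, uniform in the parity of `D`.
* §1 bookkeeping: `scaleLattice_pow_antitone`, `endoGL_sub_one_{apply_one_one, sub_smul_one, col, row}`.

## References
* [Kottwitz1986] R. E. Kottwitz, *Base change for unit elements of Hecke algebras*, Compositio Math. 60 (1986), §3 (levels of fixed lattices; reduction to Levi blocks).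
* [Rogawski1990] J. D. Rogawski, *Automorphic Representations of Unitary Groups in Three Variables*, Ann. of Math. Stud. 123 (1990), §4.8 Case (a) p. 53, §4.9 p. 55.
* [BruhatTits1972] F. Bruhat, J. Tits, *Groupes réductifs sur un corps local I*, Publ. Math. IHÉS 41 (1972), §10 (lattice models; vertex stabilisers and their filtrations).
* [Serre1980Trees] J.-P. Serre, *Trees* (1980), Ch. II §1.1 (lattices, levels).
-/

set_option autoImplicit false

noncomputable section

open scoped Valued WithZero Matrix MatrixGroups

namespace Literature.NumberTheory.Automorphic.UnitaryLatticeTree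

open Literature.NumberTheory.Automorphic Literature.NumberTheory.Automorphic.HermitianLattice Literature.NumberTheory.Rogawski1990

variable {K : Type*} [Field K] [Valued K ℤᵐ⁰]

/-! ## §1 Bookkeeping -/

/-- `ϖ^{e'}·M ≤ ϖ^e·M` for `e ≤ e'` (`|ϖ| ≤ 1`). [cite: Serre1980Trees, Ch. II §1.1] -/
theorem scaleLattice_pow_antitone {N : ℕ} {ϖ : K} (hϖ1 : Valued.v ϖ ≤ 1) (M : Submodule 𝒪[K] (Fin N → K)) {e e' : ℕ} (h : e ≤ e') :
    scaleLattice (ϖ ^ e') M ≤ scaleLattice (ϖ ^ e) M := by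
  obtain ⟨k, rfl⟩ := Nat.exists_eq_add_of_le h
  rw [pow_add, ← scaleLattice_scaleLattice]
  exact scaleLattice_mono _ (scaleLattice_le_self_of_v_le_one (by rw [map_pow]; exact pow_le_one₀ zero_le hϖ1) M)

omit [Valued K ℤᵐ⁰] in
/-- The `(1,1)` entry of `Γ − 1` is `u − 1` for `Γ = ι(γ₂, u)`. [cite: Rogawski1990, §4.8 Case (a) p. 53] -/
theorem endoGL_sub_one_apply_one_one (γ₂ : GL (Fin 2) K) (u : GL (Fin 1) K) :
    (((endoGL (γ₂, u) : GL (Fin 3) K) : Matrix (Fin 3) (Fin 3) K) - 1) 1 1 = (u : Matrix (Fin 1) (Fin 1) K) 0 0 - 1 := by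
  rw [Matrix.sub_apply, coe_endoGL_eq_endoShape, Matrix.one_apply_eq]; rfl

omit [Valued K ℤᵐ⁰] in
/-- `(Γ − 1) − (u − 1)·1 = Γ − u·1`. [cite: Rogawski1990, §4.8 Case (a) p. 53] -/
theorem endoGL_sub_one_sub_smul_one (γ₂ : GL (Fin 2) K) (u : GL (Fin 1) K) :
    (((endoGL (γ₂, u) : GL (Fin 3) K) : Matrix (Fin 3) (Fin 3) K) - 1) - (((endoGL (γ₂, u) : GL (Fin 3) K) : Matrix (Fin 3) (Fin 3) K) - 1) 1 1 • (1 : Matrix (Fin 3) (Fin 3) K) = ((endoGL (γ₂, u) : GL (Fin 3) K) : Matrix (Fin 3) (Fin 3) K) - (u : Matrix (Fin 1) (Fin 1) K) 0 0 • (1 : Matrix (Fin 3) (Fin 3) K) := by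
  rw [endoGL_sub_one_apply_one_one, sub_smul, one_smul]; abel

omit [Valued K ℤᵐ⁰] in
/-- `Γ − 1` is block at `1` (column). [cite: Rogawski1990, §4.8 Case (a) p. 53] -/
theorem endoGL_sub_one_col (γ₂ : GL (Fin 2) K) (u : GL (Fin 1) K) (l : Fin 3) (hl : l ≠ 1) : (((endoGL (γ₂, u) : GL (Fin 3) K) : Matrix (Fin 3) (Fin 3) K) - 1) l 1 = 0 := by
  rw [Matrix.sub_apply, coe_endoGL_eq_endoShape, Matrix.one_apply_ne hl]
  fin_cases l <;> simp at hl ⊢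

omit [Valued K ℤᵐ⁰] in
/-- `Γ − 1` is block at `1` (row). [cite: Rogawski1990, §4.8 Case (a) p. 53] -/
theorem endoGL_sub_one_row (γ₂ : GL (Fin 2) K) (u : GL (Fin 1) K) (l : Fin 3) (hl : l ≠ 1) : (((endoGL (γ₂, u) : GL (Fin 3) K) : Matrix (Fin 3) (Fin 3) K) - 1) 1 l = 0 := by
  rw [Matrix.sub_apply, coe_endoGL_eq_endoShape, Matrix.one_apply_ne' hl]
  fin_cases l <;> simp at hl ⊢

/-! ## §2 COLLAR TOKENS: fixedness and levels of a collar lattice from the depth of its axis vertex and ONE value -/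

/-- **COLLAR TOKENS (fixedness, levels).**  Block form; `Γ = ι(γ₂, u)`; `M` self-dual with tube coordinate `1` (a COLLAR lattice) and generator `x₀` (`|x₀,₁| = |ϖ|⁻¹`);
`A(M) = (M ∩ W) + ϖ·M + 𝒪e₁` its axis vertex; suppose `(Γ − 1)·A(M) ⊆ ϖ^D·A(M)` with `D ≥ 2` (the axis vertex has LEVEL `≥ D`).  Put `x := ϖ·x₀ ∈ A(M)` (the residual line of
`A(M)` through which `M` is glued) and `val := ϖ^{−D}·⟨x, (Γ − 1)x⟩` (`|val| ≤ 1`).  Then: **`Γ·M ⊆ M`** (the whole collar of a `2`-deep axis vertex is fixed);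
**`LEV_M(ϖ^{D−2})`**; and **`LEV_M(ϖ^{D−1}) ⟺ |val| < 1`** — the label of a collar lattice is read on the residual value of its line, as for the type-(1) root grandchildren
(★ `rootGrandchildLabels_equilateral`, ★ `offRegionGrandchildLabels`); residually `val` is ★ `…TypeTwoRamifiedCollarCensus`'s `Q(v_b) = g(A + hCb²)`.
[cite: Kottwitz1986, §3] [cite: Rogawski1990, §4.9 p. 55] [cite: BruhatTits1972, §10] -/
theorem collar_fixed_and_lev_of_axisLevel [IsPrincipalIdealRing 𝒪[K]] (σ : K →+* K) (hσ : ∀ a, σ (σ a) = a) (hvσ : ∀ a, Valued.v (σ a) = Valued.v a)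
    {ϖ : K} (hϖ : Valued.v ϖ = WithZero.exp (-1 : ℤ))
    {H₂ : Matrix (Fin 2) (Fin 2) K} (hH₂ : IsUnit H₂.det) (hH₂σ : (H₂.map σ)ᵀ = H₂) {h : K} (hh : Valued.v h = 1) (hhσ : σ h = h)
    {M : Submodule 𝒪[K] (Fin 3 → K)} (hM : IsSelfDualLattice σ ϖ (!![H₂ 0 0, 0, H₂ 0 1; 0, h, 0; H₂ 1 0, 0, H₂ 1 1] : Matrix (Fin 3) (Fin 3) K) M)
    (hb : ∀ a : K, (Pi.single 1 a : Fin 3 → K) ∈ M ↔ Valued.v a ≤ Valued.v ϖ ^ 1)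
    {x₀ : Fin 3 → K} (hx₀ : x₀ ∈ M) (hx₀1 : Valued.v (x₀ 1) * Valued.v ϖ ^ 1 = 1)
    (γ₂ : GL (Fin 2) K) (u : GL (Fin 1) K) {D : ℕ} (hD : 2 ≤ D)
    (hAlev : ∀ a ∈ M ⊓ LinearMap.ker ((LinearMap.proj (1 : Fin 3) : (Fin 3 → K) →ₗ[K] K).restrictScalars 𝒪[K]) ⊔ scaleLattice (ϖ ^ 1) M ⊔ Submodule.span 𝒪[K] {(Pi.single 1 1 : Fin 3 → K)}, (((endoGL (γ₂, u) : GL (Fin 3) K) : Matrix (Fin 3) (Fin 3) K) - 1) *ᵥ a ∈ scaleLattice (ϖ ^ D) (M ⊓ LinearMap.ker ((LinearMap.proj (1 : Fin 3) : (Fin 3 → K) →ₗ[K] K).restrictScalars 𝒪[K]) ⊔ scaleLattice (ϖ ^ 1) M ⊔ Submodule.span 𝒪[K] {(Pi.single 1 1 : Fin 3 → K)})) :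
    mapGL (endoGL (γ₂, u)) M ≤ M ∧
    (∀ y ∈ M, (((endoGL (γ₂, u) : GL (Fin 3) K) : Matrix (Fin 3) (Fin 3) K) - 1) *ᵥ y ∈ scaleLattice (ϖ ^ (D - 2)) M) ∧
    ((∀ y ∈ M, (((endoGL (γ₂, u) : GL (Fin 3) K) : Matrix (Fin 3) (Fin 3) K) - 1) *ᵥ y ∈ scaleLattice (ϖ ^ (D - 1)) M) ↔
      Valued.v ((ϖ ^ D)⁻¹ * pairing σ (!![H₂ 0 0, 0, H₂ 0 1; 0, h, 0; H₂ 1 0, 0, H₂ 1 1] : Matrix (Fin 3) (Fin 3) K) (ϖ • x₀) ((((endoGL (γ₂, u) : GL (Fin 3) K) : Matrix (Fin 3) (Fin 3) K) - 1) *ᵥ (ϖ • x₀))) < 1) := by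
  -- notation-free abbreviations
  have hY11 := endoGL_sub_one_apply_one_one γ₂ u
  have hYu := endoGL_sub_one_sub_smul_one γ₂ u
  have hYcol := endoGL_sub_one_col γ₂ u
  have hYrow := endoGL_sub_one_row γ₂ u
  have hϖ0' : Valued.v ϖ ≠ 0 := by rw [hϖ]; exact WithZero.exp_ne_zero
  have hϖ0 : ϖ ≠ 0 := fun h0 => by rw [h0, map_zero] at hϖ0'; exact hϖ0' rfl
  have hϖ1 : Valued.v ϖ ≤ 1 := by rw [hϖ, ← WithZero.exp_zero, WithZero.exp_le_exp]; omega
  have hϖD0 : ϖ ^ D ≠ 0 := pow_ne_zero _ hϖ0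
  have hϖD0' : Valued.v ϖ ^ D ≠ 0 := pow_ne_zero _ hϖ0'
  have hb1 : 1 ≤ 1 := le_refl 1
  -- axis vertex data
  obtain ⟨he₁A, hA1, hASD⟩ := isSelfDualLattice_axisVertex_of_tubeCoordinate σ hσ hvσ hϖ hH₂ hH₂σ hh hhσ hM hb
  have hAint := le_dualLatt_of_isVertexLattice hvσ hASD
  obtain ⟨hzA, -, hziso, hWiff⟩ := cone_anatomy_of_tubeCoordinate σ hvσ hϖ hH₂ hh hM hb1 hb hx₀ hx₀1
  have hϖA := scaleLattice_axisVertex_le hϖ hb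
  -- `|u − 1| ≤ |ϖ|^D` (pair the axis level with `e₁`)
  have hδ : Valued.v ((u : Matrix (Fin 1) (Fin 1) K) 0 0 - 1) ≤ Valued.v ϖ ^ D := by
    have h1 := hAlev _ he₁A
    rw [mulVec_single_one_of_block hYcol, hY11, mul_one, mem_scaleLattice_iff hϖD0] at h1
    have e : (ϖ ^ D)⁻¹ • (Pi.single 1 ((u : Matrix (Fin 1) (Fin 1) K) 0 0 - 1) : Fin 3 → K) = Pi.single 1 ((ϖ ^ D)⁻¹ * ((u : Matrix (Fin 1) (Fin 1) K) 0 0 - 1)) := by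
      ext k; rcases eq_or_ne k 1 with rfl | hk <;> simp [*]
    rw [e] at h1
    have h2 := hA1 _ h1
    rw [Pi.single_eq_same, map_mul, map_inv₀, map_pow, inv_mul_le_iff₀ (zero_lt_iff.2 hϖD0'), mul_one] at h2
    exact h2
  -- the containment `ϖ^D·A(M) ≤ ϖ^e·M` for `e + 1 ≤ D`
  have hDA : ∀ e : ℕ, e + 1 ≤ D → scaleLattice (ϖ ^ D) (M ⊓ LinearMap.ker ((LinearMap.proj (1 : Fin 3) : (Fin 3 → K) →ₗ[K] K).restrictScalars 𝒪[K]) ⊔ scaleLattice (ϖ ^ 1) M ⊔ Submodule.span 𝒪[K] {(Pi.single 1 1 : Fin 3 → K)}) ≤ scaleLattice (ϖ ^ e) M := fun e he => by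
    calc scaleLattice (ϖ ^ D) (M ⊓ LinearMap.ker ((LinearMap.proj (1 : Fin 3) : (Fin 3 → K) →ₗ[K] K).restrictScalars 𝒪[K]) ⊔ scaleLattice (ϖ ^ 1) M ⊔ Submodule.span 𝒪[K] {(Pi.single 1 1 : Fin 3 → K)}) ≤ scaleLattice (ϖ ^ (e + 1)) (M ⊓ LinearMap.ker ((LinearMap.proj (1 : Fin 3) : (Fin 3 → K) →ₗ[K] K).restrictScalars 𝒪[K]) ⊔ scaleLattice (ϖ ^ 1) M ⊔ Submodule.span 𝒪[K] {(Pi.single 1 1 : Fin 3 → K)}) := scaleLattice_pow_antitone hϖ1 _ he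
      _ = scaleLattice (ϖ ^ e) (scaleLattice (ϖ ^ 1) (M ⊓ LinearMap.ker ((LinearMap.proj (1 : Fin 3) : (Fin 3 → K) →ₗ[K] K).restrictScalars 𝒪[K]) ⊔ scaleLattice (ϖ ^ 1) M ⊔ Submodule.span 𝒪[K] {(Pi.single 1 1 : Fin 3 → K)})) := by rw [scaleLattice_scaleLattice, ← pow_add]
      _ ≤ scaleLattice (ϖ ^ e) M := scaleLattice_mono _ hϖA
  -- the W-clause at every level `e ≤ D − 1`
  have hW : ∀ e : ℕ, e + 1 ≤ D → ∀ w ∈ M, w 1 = 0 → (((endoGL (γ₂, u) : GL (Fin 3) K) : Matrix (Fin 3) (Fin 3) K) - 1) *ᵥ w ∈ scaleLattice (ϖ ^ e) M := fun e he w hw hw1 =>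
    hDA e he (hAlev w (Submodule.mem_sup_left (Submodule.mem_sup_left ⟨hw, (mem_kerProj_one_iff w).2 hw1⟩)))
  -- the generator clause: `(Γ − u)z ∈ ϖ^D·A(M)`
  have hgenD : (((endoGL (γ₂, u) : GL (Fin 3) K) : Matrix (Fin 3) (Fin 3) K) - (u : Matrix (Fin 1) (Fin 1) K) 0 0 • (1 : Matrix (Fin 3) (Fin 3) K)) *ᵥ ((ϖ ^ 1) • (x₀ - Pi.single 1 (x₀ 1))) ∈
      scaleLattice (ϖ ^ D) (M ⊓ LinearMap.ker ((LinearMap.proj (1 : Fin 3) : (Fin 3 → K) →ₗ[K] K).restrictScalars 𝒪[K]) ⊔ scaleLattice (ϖ ^ 1) M ⊔ Submodule.span 𝒪[K] {(Pi.single 1 1 : Fin 3 → K)}) := by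
    have e : (((endoGL (γ₂, u) : GL (Fin 3) K) : Matrix (Fin 3) (Fin 3) K) - (u : Matrix (Fin 1) (Fin 1) K) 0 0 • (1 : Matrix (Fin 3) (Fin 3) K)) *ᵥ ((ϖ ^ 1) • (x₀ - Pi.single 1 (x₀ 1))) =
        (((endoGL (γ₂, u) : GL (Fin 3) K) : Matrix (Fin 3) (Fin 3) K) - 1) *ᵥ ((ϖ ^ 1) • (x₀ - Pi.single 1 (x₀ 1))) - ((u : Matrix (Fin 1) (Fin 1) K) 0 0 - 1) • ((ϖ ^ 1) • (x₀ - Pi.single 1 (x₀ 1))) := by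
      rw [← hYu, sub_smul_one_mulVec, hY11]
    rw [e]
    refine Submodule.sub_mem _ (hAlev _ hzA) ?_
    rw [mem_scaleLattice_iff hϖD0, smul_smul]
    exact smul_mem_of_v_le _ (by rw [map_mul, map_inv₀, map_pow, inv_mul_le_iff₀ (zero_lt_iff.2 hϖD0'), mul_one]; exact hδ) hzA
  -- its value against `z` is `ϖ^D`-small
  have hvalD : Valued.v (pairing σ (!![H₂ 0 0, 0, H₂ 0 1; 0, h, 0; H₂ 1 0, 0, H₂ 1 1] : Matrix (Fin 3) (Fin 3) K) ((ϖ ^ 1) • (x₀ - Pi.single 1 (x₀ 1)))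
      ((((endoGL (γ₂, u) : GL (Fin 3) K) : Matrix (Fin 3) (Fin 3) K) - (u : Matrix (Fin 1) (Fin 1) K) 0 0 • (1 : Matrix (Fin 3) (Fin 3) K)) *ᵥ ((ϖ ^ 1) • (x₀ - Pi.single 1 (x₀ 1))))) ≤ Valued.v ϖ ^ D := by
    obtain ⟨a, ha, hea⟩ := (Submodule.mem_map.1 hgenD)
    rw [← hea, LinearMap.restrictScalars_apply, LinearMap.smul_apply, LinearMap.id_apply, LinearMap.map_smul, smul_eq_mul, map_mul, map_pow]
    exact (mul_le_mul' le_rfl ((mem_dualLatt σ _ _ a).1 (hAint ha) _ hzA)).trans (le_of_eq (mul_one _))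
  have hcone := fun (e : ℕ) => forall_mulVec_mem_scaleLattice_iff_of_cone σ hvσ hϖ hH₂ hh hM hb1 hb hx₀ hx₀1 hYcol hYrow (pow_ne_zero e hϖ0)
  refine ⟨?_, ?_, ?_⟩
  · -- fixedness
    rw [mapGL_endoGL_le_iff_of_tubeCoordinate σ hvσ hϖ hH₂ hh hM hb1 hb hx₀ hx₀1 γ₂ ?_]
    · refine ⟨fun w hw hw1 => ?_, (scaleLattice_pow_antitone hϖ1 _ (le_trans hb1 (le_trans one_le_two hD))) hgenD, ?_⟩
      · have e : ((endoGL (γ₂, u) : GL (Fin 3) K) : Matrix (Fin 3) (Fin 3) K) *ᵥ w = w + (((endoGL (γ₂, u) : GL (Fin 3) K) : Matrix (Fin 3) (Fin 3) K) - 1) *ᵥ w := by rw [Matrix.sub_mulVec, Matrix.one_mulVec, add_sub_cancel]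
        rw [e]
        exact M.add_mem hw (scaleLattice_le_self_of_v_le_one (by rw [map_pow]; exact pow_le_one₀ zero_le hϖ1) M (hW (D - 1) (by omega) w hw hw1))
      · rw [mul_one]; exact hvalD.trans ((v_pow_le_v_pow_iff hϖ D 2).2 hD)
    · -- `|u| = 1` from `|u − 1| ≤ |ϖ|^D < 1`
      have hlt : Valued.v ((u : Matrix (Fin 1) (Fin 1) K) 0 0 - 1) < 1 :=
        lt_of_le_of_lt hδ (by rw [← pow_zero (Valued.v ϖ), v_pow_eq_exp_neg hϖ, v_pow_eq_exp_neg hϖ, WithZero.exp_lt_exp]; omega)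
      have e : (u : Matrix (Fin 1) (Fin 1) K) 0 0 = 1 + ((u : Matrix (Fin 1) (Fin 1) K) 0 0 - 1) := by ring
      rw [e, Valuation.map_add_eq_of_lt_left _ (by rwa [map_one]), map_one]
  · -- `LEV(ϖ^{D−2})`
    refine (hcone (D - 2)).2 ⟨?_, hW (D - 2) (by omega), ?_, ?_⟩
    · rw [hY11, map_pow]; exact hδ.trans ((v_pow_le_v_pow_iff hϖ D (D - 2)).2 (by omega))
    · rw [hYu, ← pow_add]; exact (scaleLattice_pow_antitone hϖ1 _ (show 1 + (D - 2) ≤ D by omega)) hgenD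
    · rw [hYu, map_pow, ← pow_add]; exact hvalD.trans ((v_pow_le_v_pow_iff hϖ D _).2 (by omega))
  · -- `LEV(ϖ^{D−1}) ⟺ |val| < 1`
    rw [hcone (D - 1)]
    -- the three structural clauses hold at level `D − 1`
    have ha : Valued.v ((((endoGL (γ₂, u) : GL (Fin 3) K) : Matrix (Fin 3) (Fin 3) K) - 1) 1 1) ≤ Valued.v (ϖ ^ (D - 1)) := by
      rw [hY11, map_pow]; exact hδ.trans ((v_pow_le_v_pow_iff hϖ D (D - 1)).2 (by omega))
    have hc : ((((endoGL (γ₂, u) : GL (Fin 3) K) : Matrix (Fin 3) (Fin 3) K) - 1) - (((endoGL (γ₂, u) : GL (Fin 3) K) : Matrix (Fin 3) (Fin 3) K) - 1) 1 1 • (1 : Matrix (Fin 3) (Fin 3) K)) *ᵥ ((ϖ ^ 1) • (x₀ - Pi.single 1 (x₀ 1))) ∈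
        scaleLattice (ϖ ^ 1 * ϖ ^ (D - 1)) (M ⊓ LinearMap.ker ((LinearMap.proj (1 : Fin 3) : (Fin 3 → K) →ₗ[K] K).restrictScalars 𝒪[K]) ⊔ scaleLattice (ϖ ^ 1) M ⊔ Submodule.span 𝒪[K] {(Pi.single 1 1 : Fin 3 → K)}) := by
      rw [hYu, ← pow_add, show 1 + (D - 1) = D by omega]; exact hgenD
    -- the value clause: `|⟨z, (Γ − u)z⟩| ≤ |ϖ|^{D+1} ⟺ |val| < 1`
    have hx : (ϖ • x₀ : Fin 3 → K) = (ϖ ^ 1) • (x₀ - Pi.single 1 (x₀ 1)) + (ϖ * x₀ 1) • (Pi.single 1 1 : Fin 3 → K) := by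
      ext k; rcases eq_or_ne k 1 with rfl | hk
      · simp
      · simp [hk]
    have hz1 : ((ϖ ^ 1) • (x₀ - Pi.single 1 (x₀ 1)) : Fin 3 → K) 1 = 0 := by simp
    have hcv := pairing_add_single_endoGL_sub_one σ H₂ h hz1 (ϖ * x₀ 1) γ₂ u
    have hBsmall : Valued.v (((u : Matrix (Fin 1) (Fin 1) K) 0 0 - 1) *
        (pairing σ (!![H₂ 0 0, 0, H₂ 0 1; 0, h, 0; H₂ 1 0, 0, H₂ 1 1] : Matrix (Fin 3) (Fin 3) K) ((ϖ ^ 1) • (x₀ - Pi.single 1 (x₀ 1))) ((ϖ ^ 1) • (x₀ - Pi.single 1 (x₀ 1))) + σ (ϖ * x₀ 1) * h * (ϖ * x₀ 1))) ≤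
        Valued.v ϖ ^ D * Valued.v ϖ ^ 2 := by
      rw [map_mul]
      refine mul_le_mul' hδ ?_
      have e : σ (ϖ * x₀ 1) * h * (ϖ * x₀ 1) = h * σ (ϖ ^ 1 * x₀ 1) * (ϖ ^ 1 * x₀ 1) := by rw [pow_one]; ring
      have hz2 := hziso
      rw [mul_one] at hz2
      rw [e]; exact hz2
    have hpowD1 : Valued.v ϖ ^ 2 * Valued.v ϖ ^ (D - 1) = Valued.v ϖ ^ D * Valued.v ϖ := by
      rw [← pow_add, ← pow_succ, show 2 + (D - 1) = D + 1 by omega]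
    have hB' : Valued.v (((u : Matrix (Fin 1) (Fin 1) K) 0 0 - 1) *
        (pairing σ (!![H₂ 0 0, 0, H₂ 0 1; 0, h, 0; H₂ 1 0, 0, H₂ 1 1] : Matrix (Fin 3) (Fin 3) K) ((ϖ ^ 1) • (x₀ - Pi.single 1 (x₀ 1))) ((ϖ ^ 1) • (x₀ - Pi.single 1 (x₀ 1))) + σ (ϖ * x₀ 1) * h * (ϖ * x₀ 1))) ≤
        Valued.v ϖ ^ D * Valued.v ϖ :=
      hBsmall.trans (mul_le_mul' le_rfl (by rw [pow_two]; exact (mul_le_mul' le_rfl hϖ1).trans (le_of_eq (mul_one _))))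
    -- `|y| < 1 ⟺ |y| ≤ |ϖ|` in the discrete value group (★ `v_lt_one_iff_le_v_of_v_eq` needs the `ValuativeRel` bridge; here directly)
    have hlt_iff : ∀ y : K, Valued.v y < 1 ↔ Valued.v y ≤ Valued.v ϖ := fun y => by
      rw [hϖ]
      constructor
      · intro hy
        by_cases h0 : Valued.v y = 0
        · rw [h0]; exact zero_le
        · rw [← WithZero.exp_log h0, ← WithZero.exp_zero, WithZero.exp_lt_exp] at hy
          rw [← WithZero.exp_log h0, WithZero.exp_le_exp]; omega
      · intro hy; exact lt_of_le_of_lt hy (by rw [← WithZero.exp_zero, WithZero.exp_lt_exp]; omega)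
    have hval_iff : Valued.v (pairing σ (!![H₂ 0 0, 0, H₂ 0 1; 0, h, 0; H₂ 1 0, 0, H₂ 1 1] : Matrix (Fin 3) (Fin 3) K) ((ϖ ^ 1) • (x₀ - Pi.single 1 (x₀ 1)))
          (((((endoGL (γ₂, u) : GL (Fin 3) K) : Matrix (Fin 3) (Fin 3) K) - 1) - (((endoGL (γ₂, u) : GL (Fin 3) K) : Matrix (Fin 3) (Fin 3) K) - 1) 1 1 • (1 : Matrix (Fin 3) (Fin 3) K)) *ᵥ ((ϖ ^ 1) • (x₀ - Pi.single 1 (x₀ 1))))) ≤ Valued.v ϖ ^ (2 * 1) * Valued.v (ϖ ^ (D - 1)) ↔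
        Valued.v ((ϖ ^ D)⁻¹ * pairing σ (!![H₂ 0 0, 0, H₂ 0 1; 0, h, 0; H₂ 1 0, 0, H₂ 1 1] : Matrix (Fin 3) (Fin 3) K) (ϖ • x₀) ((((endoGL (γ₂, u) : GL (Fin 3) K) : Matrix (Fin 3) (Fin 3) K) - 1) *ᵥ (ϖ • x₀))) < 1 := by
      rw [hYu, mul_one, map_pow, hpowD1, hlt_iff, map_mul, map_inv₀, map_pow, inv_mul_le_iff₀ (zero_lt_iff.2 hϖD0'), hx, hcv]
      constructor
      · intro hd
        exact (Valuation.map_add _ _ _).trans (max_le hd hB')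
      · intro hsum
        have e : pairing σ (!![H₂ 0 0, 0, H₂ 0 1; 0, h, 0; H₂ 1 0, 0, H₂ 1 1] : Matrix (Fin 3) (Fin 3) K) ((ϖ ^ 1) • (x₀ - Pi.single 1 (x₀ 1)))
            ((((endoGL (γ₂, u) : GL (Fin 3) K) : Matrix (Fin 3) (Fin 3) K) - (u : Matrix (Fin 1) (Fin 1) K) 0 0 • (1 : Matrix (Fin 3) (Fin 3) K)) *ᵥ ((ϖ ^ 1) • (x₀ - Pi.single 1 (x₀ 1)))) =
            (pairing σ (!![H₂ 0 0, 0, H₂ 0 1; 0, h, 0; H₂ 1 0, 0, H₂ 1 1] : Matrix (Fin 3) (Fin 3) K) ((ϖ ^ 1) • (x₀ - Pi.single 1 (x₀ 1)))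
              ((((endoGL (γ₂, u) : GL (Fin 3) K) : Matrix (Fin 3) (Fin 3) K) - (u : Matrix (Fin 1) (Fin 1) K) 0 0 • (1 : Matrix (Fin 3) (Fin 3) K)) *ᵥ ((ϖ ^ 1) • (x₀ - Pi.single 1 (x₀ 1)))) +
              ((u : Matrix (Fin 1) (Fin 1) K) 0 0 - 1) * (pairing σ (!![H₂ 0 0, 0, H₂ 0 1; 0, h, 0; H₂ 1 0, 0, H₂ 1 1] : Matrix (Fin 3) (Fin 3) K) ((ϖ ^ 1) • (x₀ - Pi.single 1 (x₀ 1))) ((ϖ ^ 1) • (x₀ - Pi.single 1 (x₀ 1))) +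
                σ (ϖ * x₀ 1) * h * (ϖ * x₀ 1))) -
            ((u : Matrix (Fin 1) (Fin 1) K) 0 0 - 1) * (pairing σ (!![H₂ 0 0, 0, H₂ 0 1; 0, h, 0; H₂ 1 0, 0, H₂ 1 1] : Matrix (Fin 3) (Fin 3) K) ((ϖ ^ 1) • (x₀ - Pi.single 1 (x₀ 1))) ((ϖ ^ 1) • (x₀ - Pi.single 1 (x₀ 1))) +
                σ (ϖ * x₀ 1) * h * (ϖ * x₀ 1)) := by ring
        rw [e]
        exact (Valuation.map_sub _ _ _).trans (max_le hsum hB')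
    constructor
    · rintro ⟨-, -, -, hd⟩; exact hval_iff.1 hd
    · intro hv; exact ⟨ha, hW (D - 1) (by omega), hc, hval_iff.2 hv⟩


/-! ## §3 COLLAR CLASS: the depth-`(D − 2)` class of a collar lattice is the class of `−val` (∘ ★ p847504) -/

/-- **COLLAR CLASS.**  In the situation of `collar_fixed_and_lev_of_axisLevel`, if the value `val = ϖ^{−D}⟨x, (Γ − 1)x⟩` of the line is a UNIT, then the depth-`(D−2)` value
form of `M` represents the unit class of `c₀` iff `−val` lies in that class: `(∃ y ∈ M, ∃ a, |a| = 1 ∧ |ϖ^{−(D−2)}⟨y, (Γ−1)y⟩ − c₀a²| < 1) ⟺ ∃ a, |a| = 1 ∧ |val + c₀a²| < 1`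
— every `y = w + t·x₀ ∈ M` has value `≡ −t²·val` (★ `v_pairing_glued_mulVec_add_sq_mul_lt` with parent `A(M)`), realised at `y = x₀`.  This is the `1±` split of the collar.
[cite: Kottwitz1986, §3] [cite: Rogawski1990, §4.9 p. 55] [cite: BruhatTits1972, §10] -/
theorem collar_class_iff_of_axisLevel [IsPrincipalIdealRing 𝒪[K]] (σ : K →+* K) (hσ : ∀ a, σ (σ a) = a) (hvσ : ∀ a, Valued.v (σ a) = Valued.v a)
    (hres : ∀ z : K, Valued.v z ≤ 1 → Valued.v (σ z - z) < 1) {ϖ : K} (hϖ : Valued.v ϖ = WithZero.exp (-1 : ℤ)) (hσϖ : σ ϖ = -ϖ)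
    {H₂ : Matrix (Fin 2) (Fin 2) K} (hH₂ : IsUnit H₂.det) (hH₂σ : (H₂.map σ)ᵀ = H₂) {h : K} (hh : Valued.v h = 1) (hhσ : σ h = h)
    {M : Submodule 𝒪[K] (Fin 3 → K)} (hM : IsSelfDualLattice σ ϖ (!![H₂ 0 0, 0, H₂ 0 1; 0, h, 0; H₂ 1 0, 0, H₂ 1 1] : Matrix (Fin 3) (Fin 3) K) M)
    (hb : ∀ a : K, (Pi.single 1 a : Fin 3 → K) ∈ M ↔ Valued.v a ≤ Valued.v ϖ ^ 1)
    {x₀ : Fin 3 → K} (hx₀ : x₀ ∈ M) (hx₀1 : Valued.v (x₀ 1) * Valued.v ϖ ^ 1 = 1)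
    (γ₂ : GL (Fin 2) K) (u : GL (Fin 1) K) {D : ℕ} (hD : 2 ≤ D)
    (hAlev : ∀ a ∈ M ⊓ LinearMap.ker ((LinearMap.proj (1 : Fin 3) : (Fin 3 → K) →ₗ[K] K).restrictScalars 𝒪[K]) ⊔ scaleLattice (ϖ ^ 1) M ⊔ Submodule.span 𝒪[K] {(Pi.single 1 1 : Fin 3 → K)}, (((endoGL (γ₂, u) : GL (Fin 3) K) : Matrix (Fin 3) (Fin 3) K) - 1) *ᵥ a ∈ scaleLattice (ϖ ^ D) (M ⊓ LinearMap.ker ((LinearMap.proj (1 : Fin 3) : (Fin 3 → K) →ₗ[K] K).restrictScalars 𝒪[K]) ⊔ scaleLattice (ϖ ^ 1) M ⊔ Submodule.span 𝒪[K] {(Pi.single 1 1 : Fin 3 → K)}))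
    (hunit : Valued.v ((ϖ ^ D)⁻¹ * pairing σ (!![H₂ 0 0, 0, H₂ 0 1; 0, h, 0; H₂ 1 0, 0, H₂ 1 1] : Matrix (Fin 3) (Fin 3) K) (ϖ • x₀) ((((endoGL (γ₂, u) : GL (Fin 3) K) : Matrix (Fin 3) (Fin 3) K) - 1) *ᵥ (ϖ • x₀))) = 1) {c₀ : K} (hc₀ : Valued.v c₀ = 1) :
    (∃ y ∈ M, ∃ a : K, Valued.v a = 1 ∧ Valued.v ((ϖ ^ (D - 2))⁻¹ * pairing σ (!![H₂ 0 0, 0, H₂ 0 1; 0, h, 0; H₂ 1 0, 0, H₂ 1 1] : Matrix (Fin 3) (Fin 3) K) y ((((endoGL (γ₂, u) : GL (Fin 3) K) : Matrix (Fin 3) (Fin 3) K) - 1) *ᵥ y) - c₀ * a ^ 2) < 1) ↔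
      ∃ a : K, Valued.v a = 1 ∧ Valued.v ((ϖ ^ D)⁻¹ * pairing σ (!![H₂ 0 0, 0, H₂ 0 1; 0, h, 0; H₂ 1 0, 0, H₂ 1 1] : Matrix (Fin 3) (Fin 3) K) (ϖ • x₀) ((((endoGL (γ₂, u) : GL (Fin 3) K) : Matrix (Fin 3) (Fin 3) K) - 1) *ᵥ (ϖ • x₀)) + c₀ * a ^ 2) < 1 := by
  have hϖ0' : Valued.v ϖ ≠ 0 := by rw [hϖ]; exact WithZero.exp_ne_zero
  have hϖ0 : ϖ ≠ 0 := fun h0 => by rw [h0, map_zero] at hϖ0'; exact hϖ0' rfl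
  have hϖlt : Valued.v ϖ < 1 := by rw [hϖ, ← WithZero.exp_zero, WithZero.exp_lt_exp]; omega
  have hϖ1 : Valued.v ϖ ≤ 1 := hϖlt.le
  have hϖD0 : ϖ ^ D ≠ 0 := pow_ne_zero _ hϖ0
  have hpos1 : 0 < Valued.v ϖ ^ 1 := by rw [pow_one]; exact zero_lt_iff.2 hϖ0'
  have hx₀v : Valued.v (x₀ 1) = (Valued.v ϖ ^ 1)⁻¹ := eq_inv_of_mul_eq_one_left hx₀1
  have hx₀10 : x₀ 1 ≠ 0 := fun h0 => by rw [h0, map_zero, zero_mul] at hx₀1; exact zero_ne_one hx₀1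
  obtain ⟨b', hb', hpr, -⟩ := exists_tubeCoordinate σ hvσ hϖ hH₂ hh hM
  obtain ⟨hbb, -⟩ := tubeCoordinate_unique hϖ hb hb'
  have hmax : ∀ m ∈ M, Valued.v (m 1) ≤ Valued.v (x₀ 1) := fun m hm => by
    rw [hx₀v, ← one_mul (Valued.v ϖ ^ 1)⁻¹, le_mul_inv_iff₀ hpos1]; rw [hbb]; exact hpr m hm
  -- the parent lattice `A(M)`: integral, `Γ − 1` of level `ϖ^D` on it, contains `M ∩ W` and `x = ϖ·x₀`
  obtain ⟨-, -, hASD⟩ := isSelfDualLattice_axisVertex_of_tubeCoordinate σ hσ hvσ hϖ hH₂ hH₂σ hh hhσ hM hb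
  have hAint := le_dualLatt_of_isVertexLattice hvσ hASD
  have hY : ∀ a ∈ M ⊓ LinearMap.ker ((LinearMap.proj (1 : Fin 3) : (Fin 3 → K) →ₗ[K] K).restrictScalars 𝒪[K]) ⊔ scaleLattice (ϖ ^ 1) M ⊔ Submodule.span 𝒪[K] {(Pi.single 1 1 : Fin 3 → K)}, (ϖ ^ D)⁻¹ • ((((endoGL (γ₂, u) : GL (Fin 3) K) : Matrix (Fin 3) (Fin 3) K) - 1) *ᵥ a) ∈ M ⊓ LinearMap.ker ((LinearMap.proj (1 : Fin 3) : (Fin 3 → K) →ₗ[K] K).restrictScalars 𝒪[K]) ⊔ scaleLattice (ϖ ^ 1) M ⊔ Submodule.span 𝒪[K] {(Pi.single 1 1 : Fin 3 → K)} := fun a ha => (mem_scaleLattice_iff hϖD0 _ _).1 (hAlev a ha)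
  have hxA : (ϖ • x₀ : Fin 3 → K) ∈ M ⊓ LinearMap.ker ((LinearMap.proj (1 : Fin 3) : (Fin 3 → K) →ₗ[K] K).restrictScalars 𝒪[K]) ⊔ scaleLattice (ϖ ^ 1) M ⊔ Submodule.span 𝒪[K] {(Pi.single 1 1 : Fin 3 → K)} := by
    refine Submodule.mem_sup_left (Submodule.mem_sup_right ?_)
    rw [mem_scaleLattice_iff (pow_ne_zero 1 hϖ0), pow_one, smul_smul, inv_mul_cancel₀ hϖ0, one_smul]; exact hx₀
  have hWA : ∀ w ∈ M, w 1 = 0 → w ∈ M ⊓ LinearMap.ker ((LinearMap.proj (1 : Fin 3) : (Fin 3 → K) →ₗ[K] K).restrictScalars 𝒪[K]) ⊔ scaleLattice (ϖ ^ 1) M ⊔ Submodule.span 𝒪[K] {(Pi.single 1 1 : Fin 3 → K)} := fun w hw hw1 =>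
    Submodule.mem_sup_left (Submodule.mem_sup_left ⟨hw, (mem_kerProj_one_iff w).2 hw1⟩)
  have hx₀eq : (ϖ⁻¹ • (ϖ • x₀) : Fin 3 → K) = x₀ := by rw [smul_smul, inv_mul_cancel₀ hϖ0, one_smul]
  constructor
  · rintro ⟨y, hy, a, ha, hcls⟩
    obtain ⟨t, ht, htM, ht1⟩ := (mem_iff_exists_sub_smul_mem_of_coord_le 1 hx₀ hx₀10 hmax y).1 hy
    have hval := v_pairing_glued_mulVec_add_sq_mul_lt hvσ hres hσϖ hϖlt hϖ0 (!![H₂ 0 0, 0, H₂ 0 1; 0, h, 0; H₂ 1 0, 0, H₂ 1 1] : Matrix (Fin 3) (Fin 3) K) hAint (((endoGL (γ₂, u) : GL (Fin 3) K) : Matrix (Fin 3) (Fin 3) K) - 1) hD hY (hWA _ htM ht1) hxA ht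
    rw [hx₀eq, sub_add_cancel] at hval
    -- `|t| = 1`: the class is a unit, so `t²·val` is
    have ht1' : Valued.v t = 1 := by
      by_contra hne
      have htlt : Valued.v t < 1 := lt_of_le_of_ne ht hne
      have h1 : Valued.v (t ^ 2 * ((ϖ ^ D)⁻¹ * pairing σ (!![H₂ 0 0, 0, H₂ 0 1; 0, h, 0; H₂ 1 0, 0, H₂ 1 1] : Matrix (Fin 3) (Fin 3) K) (ϖ • x₀) ((((endoGL (γ₂, u) : GL (Fin 3) K) : Matrix (Fin 3) (Fin 3) K) - 1) *ᵥ (ϖ • x₀)))) < 1 := by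
        rw [map_mul, hunit, mul_one, map_pow]; exact pow_lt_one₀ zero_le htlt two_ne_zero
      have h2 : Valued.v ((ϖ ^ (D - 2))⁻¹ * pairing σ (!![H₂ 0 0, 0, H₂ 0 1; 0, h, 0; H₂ 1 0, 0, H₂ 1 1] : Matrix (Fin 3) (Fin 3) K) y ((((endoGL (γ₂, u) : GL (Fin 3) K) : Matrix (Fin 3) (Fin 3) K) - 1) *ᵥ y)) < 1 := by
        have e : (ϖ ^ (D - 2))⁻¹ * pairing σ (!![H₂ 0 0, 0, H₂ 0 1; 0, h, 0; H₂ 1 0, 0, H₂ 1 1] : Matrix (Fin 3) (Fin 3) K) y ((((endoGL (γ₂, u) : GL (Fin 3) K) : Matrix (Fin 3) (Fin 3) K) - 1) *ᵥ y) =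
            ((ϖ ^ (D - 2))⁻¹ * pairing σ (!![H₂ 0 0, 0, H₂ 0 1; 0, h, 0; H₂ 1 0, 0, H₂ 1 1] : Matrix (Fin 3) (Fin 3) K) y ((((endoGL (γ₂, u) : GL (Fin 3) K) : Matrix (Fin 3) (Fin 3) K) - 1) *ᵥ y) + t ^ 2 * ((ϖ ^ D)⁻¹ * pairing σ (!![H₂ 0 0, 0, H₂ 0 1; 0, h, 0; H₂ 1 0, 0, H₂ 1 1] : Matrix (Fin 3) (Fin 3) K) (ϖ • x₀) ((((endoGL (γ₂, u) : GL (Fin 3) K) : Matrix (Fin 3) (Fin 3) K) - 1) *ᵥ (ϖ • x₀)))) -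
              t ^ 2 * ((ϖ ^ D)⁻¹ * pairing σ (!![H₂ 0 0, 0, H₂ 0 1; 0, h, 0; H₂ 1 0, 0, H₂ 1 1] : Matrix (Fin 3) (Fin 3) K) (ϖ • x₀) ((((endoGL (γ₂, u) : GL (Fin 3) K) : Matrix (Fin 3) (Fin 3) K) - 1) *ᵥ (ϖ • x₀))) := by ring
        rw [e]; exact lt_of_le_of_lt (Valuation.map_sub _ _ _) (max_lt hval h1)
      have h3 : Valued.v (c₀ * a ^ 2) < 1 := by
        have e : c₀ * a ^ 2 = (ϖ ^ (D - 2))⁻¹ * pairing σ (!![H₂ 0 0, 0, H₂ 0 1; 0, h, 0; H₂ 1 0, 0, H₂ 1 1] : Matrix (Fin 3) (Fin 3) K) y ((((endoGL (γ₂, u) : GL (Fin 3) K) : Matrix (Fin 3) (Fin 3) K) - 1) *ᵥ y) - ((ϖ ^ (D - 2))⁻¹ * pairing σ (!![H₂ 0 0, 0, H₂ 0 1; 0, h, 0; H₂ 1 0, 0, H₂ 1 1] : Matrix (Fin 3) (Fin 3) K) y ((((endoGL (γ₂, u) : GL (Fin 3) K) : Matrix (Fin 3) (Fin 3) K) - 1)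 *ᵥ y) - c₀ * a ^ 2) := by ring
        rw [e]; exact lt_of_le_of_lt (Valuation.map_sub _ _ _) (max_lt h2 hcls)
      rw [map_mul, map_pow, hc₀, ha, one_pow, mul_one] at h3
      exact lt_irrefl _ h3
    have ht0 : t ≠ 0 := fun h0 => by rw [h0, map_zero] at ht1'; exact zero_ne_one ht1'
    refine ⟨a * t⁻¹, by rw [map_mul, map_inv₀, ha, ht1', inv_one, mul_one], ?_⟩
    -- `val + c₀(a∕t)² = t⁻²·((P + t²val) − (P − c₀a²))`
    have e : (ϖ ^ D)⁻¹ * pairing σ (!![H₂ 0 0, 0, H₂ 0 1; 0, h, 0; H₂ 1 0, 0, H₂ 1 1] : Matrix (Fin 3) (Fin 3) K) (ϖ • x₀) ((((endoGL (γ₂, u) : GL (Fin 3) K) : Matrix (Fin 3) (Fin 3) K) - 1) *ᵥ (ϖ • x₀)) + c₀ * (a * t⁻¹) ^ 2 =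
        (t⁻¹) ^ 2 * (((ϖ ^ (D - 2))⁻¹ * pairing σ (!![H₂ 0 0, 0, H₂ 0 1; 0, h, 0; H₂ 1 0, 0, H₂ 1 1] : Matrix (Fin 3) (Fin 3) K) y ((((endoGL (γ₂, u) : GL (Fin 3) K) : Matrix (Fin 3) (Fin 3) K) - 1) *ᵥ y) + t ^ 2 * ((ϖ ^ D)⁻¹ * pairing σ (!![H₂ 0 0, 0, H₂ 0 1; 0, h, 0; H₂ 1 0, 0, H₂ 1 1] : Matrix (Fin 3) (Fin 3) K) (ϖ • x₀) ((((endoGL (γ₂, u) : GL (Fin 3) K) : Matrix (Fin 3) (Fin 3) K) - 1) *ᵥ (ϖ • x₀)))) -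
          ((ϖ ^ (D - 2))⁻¹ * pairing σ (!![H₂ 0 0, 0, H₂ 0 1; 0, h, 0; H₂ 1 0, 0, H₂ 1 1] : Matrix (Fin 3) (Fin 3) K) y ((((endoGL (γ₂, u) : GL (Fin 3) K) : Matrix (Fin 3) (Fin 3) K) - 1) *ᵥ y) - c₀ * a ^ 2)) := by
      field_simp
      ring
    rw [e, map_mul, map_pow, map_inv₀, ht1', inv_one, one_pow, one_mul]
    exact lt_of_le_of_lt (Valuation.map_sub _ _ _) (max_lt hval hcls)
  · rintro ⟨a, ha, hcls⟩
    obtain ⟨a', ha', hval⟩ := v_pairing_glued_mulVec_sub_mul_sq_lt_of_unit hvσ hres hσϖ hϖlt hϖ0 (!![H₂ 0 0, 0, H₂ 0 1; 0, h, 0; H₂ 1 0, 0, H₂ 1 1] : Matrix (Fin 3) (Fin 3) K) hAint (((endoGL (γ₂, u) : GL (Fin 3) K) : Matrix (Fin 3) (Fin 3) K) - 1) hD hY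
      (Submodule.zero_mem _) hxA (t := 1) (by rw [map_one])
    rw [one_smul, zero_add, hx₀eq] at hval
    refine ⟨x₀, hx₀, a * a', by rw [map_mul, ha, ha', mul_one], ?_⟩
    -- `P − c₀(aa')² = (P + val·a'²) − a'²(val + c₀a²)`
    have e : (ϖ ^ (D - 2))⁻¹ * pairing σ (!![H₂ 0 0, 0, H₂ 0 1; 0, h, 0; H₂ 1 0, 0, H₂ 1 1] : Matrix (Fin 3) (Fin 3) K) x₀ ((((endoGL (γ₂, u) : GL (Fin 3) K) : Matrix (Fin 3) (Fin 3) K) - 1) *ᵥ x₀) - c₀ * (a * a') ^ 2 =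
        ((ϖ ^ (D - 2))⁻¹ * pairing σ (!![H₂ 0 0, 0, H₂ 0 1; 0, h, 0; H₂ 1 0, 0, H₂ 1 1] : Matrix (Fin 3) (Fin 3) K) x₀ ((((endoGL (γ₂, u) : GL (Fin 3) K) : Matrix (Fin 3) (Fin 3) K) - 1) *ᵥ x₀) - -((ϖ ^ D)⁻¹ * pairing σ (!![H₂ 0 0, 0, H₂ 0 1; 0, h, 0; H₂ 1 0, 0, H₂ 1 1] : Matrix (Fin 3) (Fin 3) K) (ϖ • x₀) ((((endoGL (γ₂, u) : GL (Fin 3) K) : Matrix (Fin 3) (Fin 3) K) - 1) *ᵥ (ϖ • x₀))) * a' ^ 2) -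
          a' ^ 2 * ((ϖ ^ D)⁻¹ * pairing σ (!![H₂ 0 0, 0, H₂ 0 1; 0, h, 0; H₂ 1 0, 0, H₂ 1 1] : Matrix (Fin 3) (Fin 3) K) (ϖ • x₀) ((((endoGL (γ₂, u) : GL (Fin 3) K) : Matrix (Fin 3) (Fin 3) K) - 1) *ᵥ (ϖ • x₀)) + c₀ * a ^ 2) := by ring
    rw [e]
    refine lt_of_le_of_lt (Valuation.map_sub _ _ _) (max_lt hval ?_)
    rw [map_mul, map_pow, ha', one_pow, one_mul]; exact hcls

/-! ## §4 COLLAR SQUARE LEVEL: `(Γ − 1)²·M ⊆ ϖ^{2D−2}·M` (so the `1±` token `LEV₂(ϖ^{2(D−2)+1})` holds on the whole collar) -/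

omit [Valued K ℤᵐ⁰] in
/-- `(Γ − 1)²` is block at `1` (column) with `(1,1)` entry `(u − 1)²`. [cite: Rogawski1990, §4.8 Case (a) p. 53] -/
theorem endoGL_sub_one_sq_col (γ₂ : GL (Fin 2) K) (u : GL (Fin 1) K) :
    (∀ l : Fin 3, l ≠ 1 → ((((endoGL (γ₂, u) : GL (Fin 3) K) : Matrix (Fin 3) (Fin 3) K) - 1) * (((endoGL (γ₂, u) : GL (Fin 3) K) : Matrix (Fin 3) (Fin 3) K) - 1)) l 1 = 0) ∧ ((((endoGL (γ₂, u) : GL (Fin 3) K) : Matrix (Fin 3) (Fin 3) K) - 1) * (((endoGL (γ₂, u) : GL (Fin 3) K) : Matrix (Fin 3) (Fin 3) K) - 1)) 1 1 = ((u : Matrix (Fin 1) (Fin 1) K) 0 0 - 1) ^ 2 := by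
  have hcol := endoGL_sub_one_col γ₂ u
  have key : ∀ l : Fin 3, ((((endoGL (γ₂, u) : GL (Fin 3) K) : Matrix (Fin 3) (Fin 3) K) - 1) * (((endoGL (γ₂, u) : GL (Fin 3) K) : Matrix (Fin 3) (Fin 3) K) - 1)) l 1 = (((endoGL (γ₂, u) : GL (Fin 3) K) : Matrix (Fin 3) (Fin 3) K) - 1) l 1 * (((endoGL (γ₂, u) : GL (Fin 3) K) : Matrix (Fin 3) (Fin 3) K) - 1) 1 1 := fun l => by
    rw [Matrix.mul_apply, Fin.sum_univ_three, hcol 0 (by decide), hcol 2 (by decide), mul_zero, mul_zero, zero_add, add_zero]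
  refine ⟨fun l hl => by rw [key, hcol l hl, zero_mul], ?_⟩
  rw [key, endoGL_sub_one_apply_one_one, sq]

/-- **COLLAR SQUARE LEVEL.**  In the situation of `collar_fixed_and_lev_of_axisLevel`: `(Γ − 1)²·M ⊆ ϖ^{2D−2}·M` — in particular the rank token `LEV₂(ϖ^{2(D−2)+1})` of the
`1±` labels holds for every collar lattice below a level-`D` axis vertex (`(Γ−1)² − (u−1)² = (Γ − 1 + (u−1))·(Γ − u)` and `(Γ − u)x₀ ∈ ϖ^{D−1}A(M)`).
[cite: Kottwitz1986, §3] [cite: Rogawski1990, §4.9 p. 55] -/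
theorem collar_levSq_of_axisLevel [IsPrincipalIdealRing 𝒪[K]] (σ : K →+* K) (hσ : ∀ a, σ (σ a) = a) (hvσ : ∀ a, Valued.v (σ a) = Valued.v a)
    {ϖ : K} (hϖ : Valued.v ϖ = WithZero.exp (-1 : ℤ))
    {H₂ : Matrix (Fin 2) (Fin 2) K} (hH₂ : IsUnit H₂.det) (hH₂σ : (H₂.map σ)ᵀ = H₂) {h : K} (hh : Valued.v h = 1) (hhσ : σ h = h)
    {M : Submodule 𝒪[K] (Fin 3 → K)} (hM : IsSelfDualLattice σ ϖ (!![H₂ 0 0, 0, H₂ 0 1; 0, h, 0; H₂ 1 0, 0, H₂ 1 1] : Matrix (Fin 3) (Fin 3) K) M)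
    (hb : ∀ a : K, (Pi.single 1 a : Fin 3 → K) ∈ M ↔ Valued.v a ≤ Valued.v ϖ ^ 1)
    {x₀ : Fin 3 → K} (hx₀ : x₀ ∈ M) (hx₀1 : Valued.v (x₀ 1) * Valued.v ϖ ^ 1 = 1)
    (γ₂ : GL (Fin 2) K) (u : GL (Fin 1) K) {D : ℕ} (hD : 2 ≤ D)
    (hAlev : ∀ a ∈ M ⊓ LinearMap.ker ((LinearMap.proj (1 : Fin 3) : (Fin 3 → K) →ₗ[K] K).restrictScalars 𝒪[K]) ⊔ scaleLattice (ϖ ^ 1) M ⊔ Submodule.span 𝒪[K] {(Pi.single 1 1 : Fin 3 → K)}, (((endoGL (γ₂, u) : GL (Fin 3) K) : Matrix (Fin 3) (Fin 3) K) - 1) *ᵥ a ∈ scaleLattice (ϖ ^ D) (M ⊓ LinearMap.ker ((LinearMap.proj (1 : Fin 3) : (Fin 3 → K) →ₗ[K] K).restrictScalars 𝒪[K]) ⊔ scaleLattice (ϖ ^ 1) M ⊔ Submodule.span 𝒪[K] {(Pi.single 1 1 : Fin 3 → K)})) :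
    ∀ y ∈ M, ((((endoGL (γ₂, u) : GL (Fin 3) K) : Matrix (Fin 3) (Fin 3) K) - 1) * (((endoGL (γ₂, u) : GL (Fin 3) K) : Matrix (Fin 3) (Fin 3) K) - 1)) *ᵥ y ∈ scaleLattice (ϖ ^ (2 * D - 2)) M := by
  have hY11 := endoGL_sub_one_apply_one_one γ₂ u
  have hYu := endoGL_sub_one_sub_smul_one γ₂ u
  have hYcol := endoGL_sub_one_col γ₂ u
  obtain ⟨hScol, hS11⟩ := endoGL_sub_one_sq_col γ₂ u
  have hϖ0' : Valued.v ϖ ≠ 0 := by rw [hϖ]; exact WithZero.exp_ne_zero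
  have hϖ0 : ϖ ≠ 0 := fun h0 => by rw [h0, map_zero] at hϖ0'; exact hϖ0' rfl
  have hϖ1 : Valued.v ϖ ≤ 1 := by rw [hϖ, ← WithZero.exp_zero, WithZero.exp_le_exp]; omega
  have hϖD0 : ϖ ^ D ≠ 0 := pow_ne_zero _ hϖ0
  have hϖD0' : Valued.v ϖ ^ D ≠ 0 := pow_ne_zero _ hϖ0'
  obtain ⟨b', hb', hpr, -⟩ := exists_tubeCoordinate σ hvσ hϖ hH₂ hh hM
  obtain ⟨hbb, -⟩ := tubeCoordinate_unique hϖ hb hb'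
  rw [← hbb] at hpr
  obtain ⟨he₁A, hA1, -⟩ := isSelfDualLattice_axisVertex_of_tubeCoordinate σ hσ hvσ hϖ hH₂ hH₂σ hh hhσ hM hb
  obtain ⟨hzA, -, -, -⟩ := cone_anatomy_of_tubeCoordinate σ hvσ hϖ hH₂ hh hM (le_refl 1) hb hx₀ hx₀1
  have hϖA := scaleLattice_axisVertex_le hϖ hb
  -- `|u − 1| ≤ |ϖ|^D`
  have hδ : Valued.v ((u : Matrix (Fin 1) (Fin 1) K) 0 0 - 1) ≤ Valued.v ϖ ^ D := by
    have h1 := hAlev _ he₁A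
    rw [mulVec_single_one_of_block hYcol, hY11, mul_one, mem_scaleLattice_iff hϖD0] at h1
    have e : (ϖ ^ D)⁻¹ • (Pi.single 1 ((u : Matrix (Fin 1) (Fin 1) K) 0 0 - 1) : Fin 3 → K) = Pi.single 1 ((ϖ ^ D)⁻¹ * ((u : Matrix (Fin 1) (Fin 1) K) 0 0 - 1)) := by
      ext k; rcases eq_or_ne k 1 with rfl | hk <;> simp [*]
    rw [e] at h1
    have h2 := hA1 _ h1
    rw [Pi.single_eq_same, map_mul, map_inv₀, map_pow, inv_mul_le_iff₀ (zero_lt_iff.2 hϖD0'), mul_one] at h2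
    exact h2
  have hδA : ∀ a ∈ M ⊓ LinearMap.ker ((LinearMap.proj (1 : Fin 3) : (Fin 3 → K) →ₗ[K] K).restrictScalars 𝒪[K]) ⊔ scaleLattice (ϖ ^ 1) M ⊔ Submodule.span 𝒪[K] {(Pi.single 1 1 : Fin 3 → K)}, ((u : Matrix (Fin 1) (Fin 1) K) 0 0 - 1) • a ∈ scaleLattice (ϖ ^ D) (M ⊓ LinearMap.ker ((LinearMap.proj (1 : Fin 3) : (Fin 3 → K) →ₗ[K] K).restrictScalars 𝒪[K]) ⊔ scaleLattice (ϖ ^ 1) M ⊔ Submodule.span 𝒪[K] {(Pi.single 1 1 : Fin 3 → K)}) := fun a ha => by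
    rw [mem_scaleLattice_iff hϖD0, smul_smul]
    exact smul_mem_of_v_le _ (by rw [map_mul, map_inv₀, map_pow, inv_mul_le_iff₀ (zero_lt_iff.2 hϖD0'), mul_one]; exact hδ) ha
  -- `ϖ^D·A(M) ≤ ϖ^{D−1}·M`, hence `ϖ^e·(ϖ^D·A(M)) ≤ ϖ^{e+D−1}·M`
  have hDA : scaleLattice (ϖ ^ D) (M ⊓ LinearMap.ker ((LinearMap.proj (1 : Fin 3) : (Fin 3 → K) →ₗ[K] K).restrictScalars 𝒪[K]) ⊔ scaleLattice (ϖ ^ 1) M ⊔ Submodule.span 𝒪[K] {(Pi.single 1 1 : Fin 3 → K)}) ≤ scaleLattice (ϖ ^ (D - 1)) M := by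
    calc scaleLattice (ϖ ^ D) (M ⊓ LinearMap.ker ((LinearMap.proj (1 : Fin 3) : (Fin 3 → K) →ₗ[K] K).restrictScalars 𝒪[K]) ⊔ scaleLattice (ϖ ^ 1) M ⊔ Submodule.span 𝒪[K] {(Pi.single 1 1 : Fin 3 → K)}) = scaleLattice (ϖ ^ (D - 1)) (scaleLattice (ϖ ^ 1) (M ⊓ LinearMap.ker ((LinearMap.proj (1 : Fin 3) : (Fin 3 → K) →ₗ[K] K).restrictScalars 𝒪[K]) ⊔ scaleLattice (ϖ ^ 1) M ⊔ Submodule.span 𝒪[K] {(Pi.single 1 1 : Fin 3 → K)})) := by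
          rw [scaleLattice_scaleLattice, ← pow_add, show D - 1 + 1 = D by omega]
      _ ≤ scaleLattice (ϖ ^ (D - 1)) M := scaleLattice_mono _ hϖA
  -- apply `Y` once more to an element of `ϖ^D·A(M)`: lands in `ϖ^{2D}·A(M) ≤ ϖ^{2D−1}·M`
  have hstep : ∀ v ∈ scaleLattice (ϖ ^ D) (M ⊓ LinearMap.ker ((LinearMap.proj (1 : Fin 3) : (Fin 3 → K) →ₗ[K] K).restrictScalars 𝒪[K]) ⊔ scaleLattice (ϖ ^ 1) M ⊔ Submodule.span 𝒪[K] {(Pi.single 1 1 : Fin 3 → K)}), ∀ t : K, Valued.v t ≤ Valued.v ϖ ^ D →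
      (((endoGL (γ₂, u) : GL (Fin 3) K) : Matrix (Fin 3) (Fin 3) K) - 1) *ᵥ v + t • v ∈ scaleLattice (ϖ ^ (2 * D - 1)) M := by
    intro v hv t ht
    rw [mem_scaleLattice_iff hϖD0] at hv
    have e : v = (ϖ ^ D) • ((ϖ ^ D)⁻¹ • v) := by rw [smul_smul, mul_inv_cancel₀ hϖD0, one_smul]
    have h1 : (((endoGL (γ₂, u) : GL (Fin 3) K) : Matrix (Fin 3) (Fin 3) K) - 1) *ᵥ v + t • v ∈ scaleLattice (ϖ ^ D) (scaleLattice (ϖ ^ D) (M ⊓ LinearMap.ker ((LinearMap.proj (1 : Fin 3) : (Fin 3 → K) →ₗ[K] K).restrictScalars 𝒪[K]) ⊔ scaleLattice (ϖ ^ 1) M ⊔ Submodule.span 𝒪[K] {(Pi.single 1 1 : Fin 3 → K)})) := by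
      rw [e, Matrix.mulVec_smul, smul_comm t (ϖ ^ D), ← smul_add]
      rw [scaleLattice, Submodule.mem_map]
      refine ⟨(((endoGL (γ₂, u) : GL (Fin 3) K) : Matrix (Fin 3) (Fin 3) K) - 1) *ᵥ ((ϖ ^ D)⁻¹ • v) + t • ((ϖ ^ D)⁻¹ • v), Submodule.add_mem _ (hAlev _ hv) ?_, rfl⟩
      rw [mem_scaleLattice_iff hϖD0, smul_smul]
      exact smul_mem_of_v_le _ (by rw [map_mul, map_inv₀, map_pow, inv_mul_le_iff₀ (zero_lt_iff.2 hϖD0'), mul_one]; exact ht) hv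
    rw [scaleLattice_scaleLattice, ← pow_add] at h1
    have h2 : scaleLattice (ϖ ^ (D + D)) (M ⊓ LinearMap.ker ((LinearMap.proj (1 : Fin 3) : (Fin 3 → K) →ₗ[K] K).restrictScalars 𝒪[K]) ⊔ scaleLattice (ϖ ^ 1) M ⊔ Submodule.span 𝒪[K] {(Pi.single 1 1 : Fin 3 → K)}) ≤ scaleLattice (ϖ ^ (2 * D - 1)) M := by
      calc scaleLattice (ϖ ^ (D + D)) (M ⊓ LinearMap.ker ((LinearMap.proj (1 : Fin 3) : (Fin 3 → K) →ₗ[K] K).restrictScalars 𝒪[K]) ⊔ scaleLattice (ϖ ^ 1) M ⊔ Submodule.span 𝒪[K] {(Pi.single 1 1 : Fin 3 → K)}) = scaleLattice (ϖ ^ D) (scaleLattice (ϖ ^ D) (M ⊓ LinearMap.ker ((LinearMap.proj (1 : Fin 3) : (Fin 3 → K) →ₗ[K] K).restrictScalars 𝒪[K]) ⊔ scaleLattice (ϖ ^ 1) M ⊔ Submodule.span 𝒪[K] {(Pi.single 1 1 : Fin 3 → K)})) := by rw [scaleLattice_scaleLattice, ← pow_add]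
        _ ≤ scaleLattice (ϖ ^ D) (scaleLattice (ϖ ^ (D - 1)) M) := scaleLattice_mono _ hDA
        _ = scaleLattice (ϖ ^ (2 * D - 1)) M := by rw [scaleLattice_scaleLattice, ← pow_add, show D + (D - 1) = 2 * D - 1 by omega]
    exact h2 h1
  refine (forall_mulVec_mem_scaleLattice_iff_of_tubeCoordinate hϖ hScol (pow_ne_zero _ hϖ0) hb hpr hx₀ hx₀1).2 ⟨?_, ?_, ?_⟩
  · rw [hS11, map_pow, map_pow]
    refine (pow_le_pow_left₀ zero_le hδ 2).trans ?_
    rw [← pow_mul]; exact (v_pow_le_v_pow_iff hϖ (D * 2) (2 * D - 2)).2 (by omega)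
  · intro w hw hw1
    have hwA : w ∈ M ⊓ LinearMap.ker ((LinearMap.proj (1 : Fin 3) : (Fin 3 → K) →ₗ[K] K).restrictScalars 𝒪[K]) ⊔ scaleLattice (ϖ ^ 1) M ⊔ Submodule.span 𝒪[K] {(Pi.single 1 1 : Fin 3 → K)} := Submodule.mem_sup_left (Submodule.mem_sup_left ⟨hw, (mem_kerProj_one_iff w).2 hw1⟩)
    rw [← Matrix.mulVec_mulVec]
    have h1 := hstep _ (hAlev w hwA) 0 (by rw [map_zero]; exact zero_le)
    rw [zero_smul, add_zero] at h1
    exact scaleLattice_pow_antitone hϖ1 M (by omega) h1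
  · -- generator: `(Y² − δ²)x₀ = (Y + δ)((Γ − u)x₀)` with `(Γ − u)x₀ = ϖ⁻¹(Γ − u)z ∈ ϖ^{D−1}A(M)`
    have hgenD : (((endoGL (γ₂, u) : GL (Fin 3) K) : Matrix (Fin 3) (Fin 3) K) - (u : Matrix (Fin 1) (Fin 1) K) 0 0 • (1 : Matrix (Fin 3) (Fin 3) K)) *ᵥ ((ϖ ^ 1) • (x₀ - Pi.single 1 (x₀ 1))) ∈
        scaleLattice (ϖ ^ D) (M ⊓ LinearMap.ker ((LinearMap.proj (1 : Fin 3) : (Fin 3 → K) →ₗ[K] K).restrictScalars 𝒪[K]) ⊔ scaleLattice (ϖ ^ 1) M ⊔ Submodule.span 𝒪[K] {(Pi.single 1 1 : Fin 3 → K)}) := by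
      have e : (((endoGL (γ₂, u) : GL (Fin 3) K) : Matrix (Fin 3) (Fin 3) K) - (u : Matrix (Fin 1) (Fin 1) K) 0 0 • (1 : Matrix (Fin 3) (Fin 3) K)) *ᵥ ((ϖ ^ 1) • (x₀ - Pi.single 1 (x₀ 1))) =
          (((endoGL (γ₂, u) : GL (Fin 3) K) : Matrix (Fin 3) (Fin 3) K) - 1) *ᵥ ((ϖ ^ 1) • (x₀ - Pi.single 1 (x₀ 1))) - ((u : Matrix (Fin 1) (Fin 1) K) 0 0 - 1) • ((ϖ ^ 1) • (x₀ - Pi.single 1 (x₀ 1))) := by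
        rw [← hYu, sub_smul_one_mulVec, hY11]
      rw [e]; exact Submodule.sub_mem _ (hAlev _ hzA) (hδA _ hzA)
    -- `(Γ − u)x₀` in terms of `z`
    have hΓu : (((endoGL (γ₂, u) : GL (Fin 3) K) : Matrix (Fin 3) (Fin 3) K) - (u : Matrix (Fin 1) (Fin 1) K) 0 0 • (1 : Matrix (Fin 3) (Fin 3) K)) *ᵥ x₀ =
        ϖ⁻¹ • ((((endoGL (γ₂, u) : GL (Fin 3) K) : Matrix (Fin 3) (Fin 3) K) - (u : Matrix (Fin 1) (Fin 1) K) 0 0 • (1 : Matrix (Fin 3) (Fin 3) K)) *ᵥ ((ϖ ^ 1) • (x₀ - Pi.single 1 (x₀ 1)))) := by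
      rw [Matrix.mulVec_smul, smul_smul, pow_one, inv_mul_cancel₀ hϖ0, one_smul, Matrix.mulVec_sub, Matrix.sub_mulVec, Matrix.sub_mulVec,
        endoGL_mulVec_single_one, Matrix.smul_mulVec, Matrix.one_mulVec, Matrix.smul_mulVec, Matrix.one_mulVec]
      have e : ((u : Matrix (Fin 1) (Fin 1) K) 0 0) • (Pi.single 1 (x₀ 1) : Fin 3 → K) = Pi.single 1 ((u : Matrix (Fin 1) (Fin 1) K) 0 0 * x₀ 1) := by
        ext k; rcases eq_or_ne k 1 with rfl | hk <;> simp [*]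
      rw [e, sub_self, sub_zero]
    have efac : ((((endoGL (γ₂, u) : GL (Fin 3) K) : Matrix (Fin 3) (Fin 3) K) - 1) * (((endoGL (γ₂, u) : GL (Fin 3) K) : Matrix (Fin 3) (Fin 3) K) - 1)) *ᵥ x₀ - ((((endoGL (γ₂, u) : GL (Fin 3) K) : Matrix (Fin 3) (Fin 3) K) - 1) * (((endoGL (γ₂, u) : GL (Fin 3) K) : Matrix (Fin 3) (Fin 3) K) - 1)) 1 1 • x₀ =
        (((endoGL (γ₂, u) : GL (Fin 3) K) : Matrix (Fin 3) (Fin 3) K) - 1) *ᵥ (((((endoGL (γ₂, u) : GL (Fin 3) K) : Matrix (Fin 3) (Fin 3) K) - 1) - (((endoGL (γ₂, u) : GL (Fin 3) K) : Matrix (Fin 3) (Fin 3) K) - 1) 1 1 • (1 : Matrix (Fin 3) (Fin 3) K)) *ᵥ x₀) +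
          (((endoGL (γ₂, u) : GL (Fin 3) K) : Matrix (Fin 3) (Fin 3) K) - 1) 1 1 • (((((endoGL (γ₂, u) : GL (Fin 3) K) : Matrix (Fin 3) (Fin 3) K) - 1) - (((endoGL (γ₂, u) : GL (Fin 3) K) : Matrix (Fin 3) (Fin 3) K) - 1) 1 1 • (1 : Matrix (Fin 3) (Fin 3) K)) *ᵥ x₀) := by
      rw [hS11, ← Matrix.mulVec_mulVec, sub_smul_one_mulVec, hY11, Matrix.mulVec_sub, Matrix.mulVec_smul, smul_sub, smul_smul, sq]
      abel
    rw [efac, hYu, hY11, hΓu, Matrix.mulVec_smul, smul_comm ((u : Matrix (Fin 1) (Fin 1) K) 0 0 - 1) ϖ⁻¹, ← smul_add]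
    -- the bracket lies in `ϖ^{2D−1}·M`; dividing by `ϖ` lands in `ϖ^{2D−2}·M`
    have hin := hstep _ hgenD ((u : Matrix (Fin 1) (Fin 1) K) 0 0 - 1) hδ
    rw [mem_scaleLattice_iff (pow_ne_zero _ hϖ0)] at hin ⊢
    rw [smul_smul, show (ϖ ^ (2 * D - 2))⁻¹ * ϖ⁻¹ = (ϖ ^ (2 * D - 1))⁻¹ by
      rw [← mul_inv, ← pow_succ, show 2 * D - 2 + 1 = 2 * D - 1 by omega]]
    exact hin

end Literature.NumberTheory.Automorphic.UnitaryLatticeTree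

end
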